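import Literature.RepresentationTheory.MoeglinVignerasWaldspurger1987.RankOneThetaLiftTwistRigidityOfNonPeriodic
import Literature.RepresentationTheory.MoeglinVignerasWaldspurger1987.RankOneThetaLiftFrameTwist
import Literature.RepresentationTheory.MoeglinVignerasWaldspurger1987.RankOneThetaLiftTwistRigidBlock
import HarnessLib

-- buildfix G11b-3 recipe (as in the GelbartRogawski1991 siblings): sequential elaboration.
set_option Elab.async false

/-!
# Row IV-4c3 `rankOne_theta_twist_rigidity` MODULO the rank-1×1 non-periodicity ALONE (route R glue)

Topic `RepresentationTheory/MoeglinVignerasWaldspurger1987`; namespace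
`Literature.RepresentationTheory.MoeglinVignerasWaldspurger1987`.  KERNEL only: theorems; no definition, no named fact,
no `sorry`; nothing of HC_CM or of the named fact `rankOne_theta_twist_rigidity` is asserted unconditionally.

The wrapper `rankOne_theta_twist_rigidity_of_nonPeriodic₁₁ (hNP) (hframe) (hblock)`
(`RankOneThetaLiftTwistRigidityOfNonPeriodic.lean`) isolates three inputs of row IV-4c3.  Two of them are theorems of
the tree, and this file discharges them BY NAME:

* `twistRigid_of_frame` = `hframe` — one-section twist rigidity at `(T, v)` follows from the same at a rationally
  congruent frame `(Pᵀ T P, v)`: `twistRigid_of_frameTransport` + `exists_coinvFrameEquiv`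
  (`RankOneThetaLiftFrameTwist.lean`, on the frame transport `FrameTransport.frameSection` of
  `GelbartRogawski1991/LocalUnitaryFrameTransport.lean`, which lies over `ι_v` and preserves smoothness);
* `twistRigid_block` = `hblock` — one-section twist rigidity at a block frame `t ⊕ᶠ T_H` with `(E_v², T_H ⊗ 1)`
  isotropic, modulo non-periodicity of the line block: `twistRigid_block_of_nonPeriodic`
  (`RankOneThetaLiftTwistRigidBlock.lean`).

Hence **`rankOne_theta_twist_rigidity_of_nonPeriodic₁₁' (hNP) : rankOne_theta_twist_rigidity`**: row IV-4c3
([Liu2021, Lem. D.1 (3)] `μ`-clause at `n = 3`, non-split place; [GelbartRogawski1991, pp. 461–462] ⇝ [GR90, Prop.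
5.1.4]) holds MODULO the single rank `1 × 1` statement `hNP` (non-periodicity of the type set of the `(U(1), U(1))`
oscillator representation — the explicit ε-dichotomy, [HarrisKudlaSweet1996, Thm. 6.1], not in the tree).  HC_CM is
proved only modulo the printed citations until rung 0 closes.

## References
* [MoeglinVignerasWaldspurger1987] C. Mœglin, M.-F. Vignéras, J.-L. Waldspurger, LNM 1291 (1987), Chap. 2 II Rem. (3),
  Chap. 3 IV.2–IV.4.
* [GelbartRogawski1991] S. Gelbart, J. Rogawski, Invent. Math. 105 (1991), §3 pp. 455–462.
* [HarrisKudlaSweet1996] M. Harris, S. Kudla, W. Sweet, J. AMS 9 (1996), Thm. 6.1.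
* [Liu2021] Y. Liu, Camb. J. Math. 9 (2021), App. D Lem. D.1 (3).
-/

set_option autoImplicit false

noncomputable section

open NumberField IsDedekindDomain Matrix
open scoped Matrix MatrixGroups
open Literature.RepresentationTheory (SeesawScalar.twist SeesawScalar.twist_apply)
open Literature.RepresentationTheory.HeisenbergGroup
open Literature.NumberTheory.GelbartRogawski1991.UnitaryDualPair.LocalSplitting
open Literature.NumberTheory.GelbartRogawski1991.UnitaryDualPair.LocalSplitting.BlockSum
open Literature.NumberTheory.GelbartRogawski1991.UnitaryDualPair.LocalSplitting.FrameTransport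
open Literature.NumberTheory.Automorphic
open Literature.NumberTheory.Automorphic.UnitaryGroup
open Literature.NumberTheory.Automorphic.Liu2021

namespace Literature.RepresentationTheory.MoeglinVignerasWaldspurger1987

-- thirty-binder currencies of the wrapper's hypotheses; about 2× the default budget
set_option maxHeartbeats 400000 in
/-- **`hframe` of the wrapper is a theorem**: one-section twist rigidity at `(T, J, v)` follows from one-section twist
rigidity at the rationally congruent frame `(T' = Pᵀ T P, J', v)`, `P ∈ GL₃(F)` — apply the latter to the transported
section `frameSection s` (over `ι_v` by `proj_frameSection`, smooth by `isSmooth_frameSection`, with non-zero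
`χ`-coinvariants by `exists_coinvFrameEquiv`) and descend with `twistRigid_of_frameTransport`.
[cite: MoeglinVignerasWaldspurger1987, Chap. 2 II Remarque (3) and Chap. 3 IV.4] -/
theorem twistRigid_of_frame :
    ∀ (F : Type) [Field F] [NumberField F] (E : Type) [Field E] [NumberField E] [Algebra F E]
      [Algebra.IsQuadraticExtension F E] (c : E ≃ₐ[F] E) (δ : E) (hcδ : c δ = -δ) (hδ : δ ≠ 0) (d : F)
      (hd : δ * δ = algebraMap F E d) (T T' : Matrix (Fin 3) (Fin 3) F) (hT : T.IsSymm) (hT' : T'.IsSymm)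
      (_hTd : IsUnit T.det) (_hT'd : IsUnit T'.det)
      (J : Matrix (Fin 3) (Fin 3) E) (hJ : J = T.map (algebraMap F E))
      (J' : Matrix (Fin 3) (Fin 3) E) (hJ' : J' = T'.map (algebraMap F E))
      (P : GL (Fin 3) F) (_hP : (P : Matrix (Fin 3) (Fin 3) F)ᵀ * T * (P : Matrix (Fin 3) (Fin 3) F) = T')
      (v : HeightOneSpectrum (𝓞 F)) (_hE : IsField (UnitaryGroup.LocalRing E v)),
      -- one-section twist rigidity at `(T', J', v)` …
      (∀ (s : localPi E c 3 J' v →* LocalMp F 3 T' v)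
        (_hs : ∀ g, MpPsi.proj _ (s g) = iota F E c 3 hcδ hδ hd T' hT' hJ' v g)
        (_hsm : Representation.IsSmooth ((MpPsi.toRep (localSchrodinger F 3 T' v)).comp s))
        (η : localPi E c 3 J' v →* ℂˣ) (_hη : IsOpen ((η.ker : Subgroup (localPi E c 3 J' v)) : Set (localPi E c 3 J' v)))
        (J₁ : Matrix (Fin 1) (Fin 1) E) (hJ₁ : J₁ 0 0 ≠ 0) (χ χ' : localPi E c 1 J₁ v →* ℂˣ)
        (_hχu : ∀ z, ‖((χ z : ℂˣ) : ℂ)‖ = 1) (_hχc : Continuous fun z => ((χ z : ℂˣ) : ℂ))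
        (_hχ'u : ∀ z, ‖((χ' z : ℂˣ) : ℂ)‖ = 1) (_hχ'c : Continuous fun z => ((χ' z : ℂˣ) : ℂ))
        (_hnt : Nontrivial (TwistedCoinv.Coinv
          ((show Representation ℂ (localPi E c 1 J₁ v) (SchwartzBruhat (Fin 3 → v.adicCompletion F)) from
            ((MpPsi.toRep (localSchrodinger F 3 T' v)).comp s).comp (localCenter E c 3 J' J₁ hJ₁ v))) χ))
        (_hiso : AreIsomorphicRep
          (TwistedCoinv.rep
            (ρW := show Representation ℂ (localPi E c 1 J₁ v) (SchwartzBruhat (Fin 3 → v.adicCompletion F)) from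
              ((MpPsi.toRep (localSchrodinger F 3 T' v)).comp s).comp (localCenter E c 3 J' J₁ hJ₁ v))
            χ ((MpPsi.toRep (localSchrodinger F 3 T' v)).comp s)
            (fun g z => (show Commute g (localCenter E c 3 J' J₁ hJ₁ v z) from
              localCenter_comm E c 3 J' J₁ hJ₁ v z g).map ((MpPsi.toRep (localSchrodinger F 3 T' v)).comp s)))
          (SeesawScalar.twist η (TwistedCoinv.rep
            (ρW := show Representation ℂ (localPi E c 1 J₁ v) (SchwartzBruhat (Fin 3 → v.adicCompletion F)) from
              ((MpPsi.toRep (localSchrodinger F 3 T' v)).comp s).comp (localCenter E c 3 J' J₁ hJ₁ v))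
            χ' ((MpPsi.toRep (localSchrodinger F 3 T' v)).comp s)
            (fun g z => (show Commute g (localCenter E c 3 J' J₁ hJ₁ v z) from
              localCenter_comm E c 3 J' J₁ hJ₁ v z g).map ((MpPsi.toRep (localSchrodinger F 3 T' v)).comp s))))),
        η = 1) →
      -- … implies one-section twist rigidity at `(T, J, v)`
      ∀ (s : localPi E c 3 J v →* LocalMp F 3 T v)
        (_hs : ∀ g, MpPsi.proj _ (s g) = iota F E c 3 hcδ hδ hd T hT hJ v g)
        (_hsm : Representation.IsSmooth ((MpPsi.toRep (localSchrodinger F 3 T v)).comp s))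
        (η : localPi E c 3 J v →* ℂˣ) (_hη : IsOpen ((η.ker : Subgroup (localPi E c 3 J v)) : Set (localPi E c 3 J v)))
        (J₁ : Matrix (Fin 1) (Fin 1) E) (hJ₁ : J₁ 0 0 ≠ 0) (χ χ' : localPi E c 1 J₁ v →* ℂˣ)
        (_hχu : ∀ z, ‖((χ z : ℂˣ) : ℂ)‖ = 1) (_hχc : Continuous fun z => ((χ z : ℂˣ) : ℂ))
        (_hχ'u : ∀ z, ‖((χ' z : ℂˣ) : ℂ)‖ = 1) (_hχ'c : Continuous fun z => ((χ' z : ℂˣ) : ℂ))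
        (_hnt : Nontrivial (TwistedCoinv.Coinv
          ((show Representation ℂ (localPi E c 1 J₁ v) (SchwartzBruhat (Fin 3 → v.adicCompletion F)) from
            ((MpPsi.toRep (localSchrodinger F 3 T v)).comp s).comp (localCenter E c 3 J J₁ hJ₁ v))) χ))
        (_hiso : AreIsomorphicRep
          (TwistedCoinv.rep
            (ρW := show Representation ℂ (localPi E c 1 J₁ v) (SchwartzBruhat (Fin 3 → v.adicCompletion F)) from
              ((MpPsi.toRep (localSchrodinger F 3 T v)).comp s).comp (localCenter E c 3 J J₁ hJ₁ v))
            χ ((MpPsi.toRep (localSchrodinger F 3 T v)).comp s)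
            (fun g z => (show Commute g (localCenter E c 3 J J₁ hJ₁ v z) from
              localCenter_comm E c 3 J J₁ hJ₁ v z g).map ((MpPsi.toRep (localSchrodinger F 3 T v)).comp s)))
          (SeesawScalar.twist η (TwistedCoinv.rep
            (ρW := show Representation ℂ (localPi E c 1 J₁ v) (SchwartzBruhat (Fin 3 → v.adicCompletion F)) from
              ((MpPsi.toRep (localSchrodinger F 3 T v)).comp s).comp (localCenter E c 3 J J₁ hJ₁ v))
            χ' ((MpPsi.toRep (localSchrodinger F 3 T v)).comp s)
            (fun g z => (show Commute g (localCenter E c 3 J J₁ hJ₁ v z) from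
              localCenter_comm E c 3 J J₁ hJ₁ v z g).map ((MpPsi.toRep (localSchrodinger F 3 T v)).comp s))))),
        η = 1 := by
  intro F _ _ E _ _ _ _ c δ hcδ hδ d hd T T' hT hT' _hTd _hT'd J hJ J' hJ' P hP v _hE h' s hs hsm η hη J₁ hJ₁ χ χ' hχu hχc
    hχ'u hχ'c hnt hiso
  -- no `obtain` here: destructuring hypotheses of this size by `rcases` exhausts the heartbeat budget
  exact (exists_coinvFrameEquiv F E c v 3 hJ hJ' P hP s hJ₁ χ).elim fun e _ =>
    twistRigid_of_frameTransport F E c v 3 hJ hJ' P hP s hJ₁ χ χ'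
      (fun η' hη' hiso' => h' (frameSection F E c v 3 hJ hJ' P hP s)
        (proj_frameSection F E c v 3 hJ hJ' P hP s hcδ hδ hd hT hT' hs) (isSmooth_frameSection F E c v 3 hJ hJ' P hP s hsm)
        η' hη' J₁ hJ₁ χ χ' hχu hχc hχ'u hχ'c (e.toEquiv.nontrivial_congr.1 hnt) hiso')
      η hη hiso

-- thirty-binder currencies of the wrapper's hypotheses; about 2× the default budget
set_option maxHeartbeats 400000 in
/-- **`hblock` of the wrapper is a theorem**: `twistRigid_block_of_nonPeriodic` (`RankOneThetaLiftTwistRigidBlock.lean`)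
in the wrapper's binder order. [cite: MoeglinVignerasWaldspurger1987, Chap. 3 IV.4 and Chap. 2 II.1 Rem. (6)]
[cite: GelbartRogawski1991, §3 pp. 461–462] -/
theorem twistRigid_block :
    ∀ (F : Type) [Field F] [NumberField F] (E : Type) [Field E] [NumberField E] [Algebra F E]
      [Algebra.IsQuadraticExtension F E] (c : E ≃ₐ[F] E) (δ : E) (hcδ : c δ = -δ) (hδ : δ ≠ 0) (d : F)
      (hd : δ * δ = algebraMap F E d) (v : HeightOneSpectrum (𝓞 F))
      (t : Matrix (Fin 1) (Fin 1) F) (T₂ : Matrix (Fin 2) (Fin 2) F) (ht : t.IsSymm) (hT₂ : T₂.IsSymm)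
      (_htd : IsUnit t.det) (hT₂d : IsUnit T₂.det)
      (J₁ : Matrix (Fin 1) (Fin 1) E) (hJ₁ : J₁ = t.map (algebraMap F E))
      (J₂ : Matrix (Fin 2) (Fin 2) E) (_hJ₂ : J₂ = T₂.map (algebraMap F E))
      (J : Matrix (Fin (1 + 2)) (Fin (1 + 2)) E) (hJ : J = (UnitaryGroup.finSum 1 2 t T₂).map (algebraMap F E))
      (s : localPi E c (1 + 2) J v →* LocalMp F (1 + 2) (UnitaryGroup.finSum 1 2 t T₂) v)
      (hs : ∀ g, MpPsi.proj _ (s g) =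
        iota F E c (1 + 2) hcδ hδ hd (UnitaryGroup.finSum 1 2 t T₂) (UnitaryGroup.isSymm_finSum ht hT₂) hJ v g)
      (J' : Matrix (Fin 1) (Fin 1) E) (hJ' : J' 0 0 ≠ 0)
      (_hE : IsField (UnitaryGroup.LocalRing E v))
      (_hsm : Representation.IsSmooth ((MpPsi.toRep (localSchrodinger F (1 + 2) (UnitaryGroup.finSum 1 2 t T₂) v)).comp s))
      (hJ₂h : (J₂.map c)ᵀ = J₂) (hJ₂det : J₂.det ≠ 0)
      (_hiso₂ : LemD1.IsIsotropic (LemD1OfPlace.standingData E v c 2 J₂ hcδ hδ (le_refl 2) hJ₂h hJ₂det))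
      (_hNP : ∀ (η₁ : localPi E c 1 J₁ v →* ℂˣ),
        IsOpen ((η₁.ker : Subgroup (localPi E c 1 J₁ v)) : Set (localPi E c 1 J₁ v)) →
        (∀ (ξ : localPi E c 1 J₁ v →* ℂˣ), (∀ u, ‖((ξ u : ℂˣ) : ℂ)‖ = 1) → (Continuous fun u => ((ξ u : ℂˣ) : ℂ)) →
          (Nontrivial (TwistedCoinv.Coinv ((MpPsi.toRep (localSchrodinger F 1 t v)).comp
              (restrictLeft F E c v 1 2 hJ₁ hJ hcδ hδ hd ht hT₂ hT₂d s hs)) ξ) ↔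
            Nontrivial (TwistedCoinv.Coinv ((MpPsi.toRep (localSchrodinger F 1 t v)).comp
              (restrictLeft F E c v 1 2 hJ₁ hJ hcδ hδ hd ht hT₂ hT₂d s hs)) (ξ * η₁)))) → η₁ = 1)
      (η : localPi E c (1 + 2) J v →* ℂˣ)
      (_hη : IsOpen ((η.ker : Subgroup (localPi E c (1 + 2) J v)) : Set (localPi E c (1 + 2) J v)))
      (χ χ' : localPi E c 1 J' v →* ℂˣ) (_hχu : ∀ z, ‖((χ z : ℂˣ) : ℂ)‖ = 1)
      (_hχc : Continuous fun z => ((χ z : ℂˣ) : ℂ))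
      (_hχ'u : ∀ z, ‖((χ' z : ℂˣ) : ℂ)‖ = 1) (_hχ'c : Continuous fun z => ((χ' z : ℂˣ) : ℂ))
      (_hiso : AreIsomorphicRep
        (TwistedCoinv.rep
          (ρW := ((MpPsi.toRep (localSchrodinger F (1 + 2) (UnitaryGroup.finSum 1 2 t T₂) v)).comp s).comp
            (localCenter E c (1 + 2) J J' hJ' v))
          χ ((MpPsi.toRep (localSchrodinger F (1 + 2) (UnitaryGroup.finSum 1 2 t T₂) v)).comp s)
          (fun g z => (show Commute g (localCenter E c (1 + 2) J J' hJ' v z) from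
            localCenter_comm E c (1 + 2) J J' hJ' v z g).map
              ((MpPsi.toRep (localSchrodinger F (1 + 2) (UnitaryGroup.finSum 1 2 t T₂) v)).comp s)))
        (SeesawScalar.twist η (TwistedCoinv.rep
          (ρW := ((MpPsi.toRep (localSchrodinger F (1 + 2) (UnitaryGroup.finSum 1 2 t T₂) v)).comp s).comp
            (localCenter E c (1 + 2) J J' hJ' v))
          χ' ((MpPsi.toRep (localSchrodinger F (1 + 2) (UnitaryGroup.finSum 1 2 t T₂) v)).comp s)
          (fun g z => (show Commute g (localCenter E c (1 + 2) J J' hJ' v z) from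
            localCenter_comm E c (1 + 2) J J' hJ' v z g).map
              ((MpPsi.toRep (localSchrodinger F (1 + 2) (UnitaryGroup.finSum 1 2 t T₂) v)).comp s))))),
      η = 1 :=
  fun F _ _ E _ _ _ _ c _δ hcδ hδ _d hd v _t _T₂ ht hT₂ htd hT₂d _J₁ hJ₁ _J₂ hJ₂ _J hJ s hs _J' hJ' hE hsm hJ₂h hJ₂det hiso₂
      hNP η hη χ χ' hχu hχc hχ'u hχ'c hiso =>
    twistRigid_block_of_nonPeriodic F E c hcδ hδ hd v ht hT₂ htd hT₂d hJ₁ hJ₂ hJ s hs hJ' hE hsm hJ₂h hJ₂det hiso₂ hNP η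
      hη χ χ' hχu hχc hχ'u hχ'c hiso

-- thirty-binder currency of `hNP`; about 2× the default budget
set_option maxHeartbeats 400000 in
/-- **ROW IV-4c3 MODULO THE RANK `1 × 1` NON-PERIODICITY ALONE.**  The named fact `rankOne_theta_twist_rigidity`
(«`Θ_{s₁}(χ₁) ≅ Θ_{s₂}(χ₂) ≠ 0 ⇒ s₁ = s₂`» for the rank-one theta lift to `U(3)` at a non-split place) follows from
`hNP`: for every `1 × 1` Gram matrix `t`, non-split `v`, section `s₁` of `U(J_t)(F_v) = E_v¹` over `ι_v` with `ω_{s₁}`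
smooth and character `η₁` with open kernel, invariance of `ξ ↦ [Coinv_ξ(ω_{s₁}) ≠ 0]` under `ξ ↦ ξ·η₁` forces `η₁ = 1`
(the wrapper `rankOne_theta_twist_rigidity_of_nonPeriodic₁₁` with `hframe := twistRigid_of_frame` and
`hblock := twistRigid_block`).  HC_CM is proved only modulo the printed citations until rung 0 closes.
[cite: Liu2021, App. D Lemma D.1 (3) (l. 5233), proof l. 5255] [cite: GelbartRogawski1991, §3 pp. 461–462]
[cite: MoeglinVignerasWaldspurger1987, Chap. 3 IV.4] -/
theorem rankOne_theta_twist_rigidity_of_nonPeriodic₁₁'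
    (hNP : ∀ (F : Type) [Field F] [NumberField F] (E : Type) [Field E] [NumberField E] [Algebra F E]
      [Algebra.IsQuadraticExtension F E] (c : E ≃ₐ[F] E) (δ : E) (hcδ : c δ = -δ) (hδ : δ ≠ 0) (d : F)
      (hd : δ * δ = algebraMap F E d) (t : Matrix (Fin 1) (Fin 1) F) (ht : t.IsSymm) (_htd : IsUnit t.det)
      (J₁ : Matrix (Fin 1) (Fin 1) E) (hJ₁ : J₁ = t.map (algebraMap F E)) (v : HeightOneSpectrum (𝓞 F))
      (_hE : IsField (UnitaryGroup.LocalRing E v))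
      (s₁ : localPi E c 1 J₁ v →* LocalMp F 1 t v)
      (_hs₁ : ∀ g, MpPsi.proj _ (s₁ g) = iota F E c 1 hcδ hδ hd t ht hJ₁ v g)
      (_hsm₁ : Representation.IsSmooth ((MpPsi.toRep (localSchrodinger F 1 t v)).comp s₁))
      (η₁ : localPi E c 1 J₁ v →* ℂˣ)
      (_hη₁ : IsOpen ((η₁.ker : Subgroup (localPi E c 1 J₁ v)) : Set (localPi E c 1 J₁ v))),
      (∀ (ξ : localPi E c 1 J₁ v →* ℂˣ), (∀ u, ‖((ξ u : ℂˣ) : ℂ)‖ = 1) → (Continuous fun u => ((ξ u : ℂˣ) : ℂ)) →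
        (Nontrivial (TwistedCoinv.Coinv ((MpPsi.toRep (localSchrodinger F 1 t v)).comp s₁) ξ) ↔
          Nontrivial (TwistedCoinv.Coinv ((MpPsi.toRep (localSchrodinger F 1 t v)).comp s₁) (ξ * η₁)))) →
      η₁ = 1) :
    rankOne_theta_twist_rigidity :=
  rankOne_theta_twist_rigidity_of_nonPeriodic₁₁ hNP twistRigid_of_frame twistRigid_block

end Literature.RepresentationTheory.MoeglinVignerasWaldspurger1987

end
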